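import Mathlib
import Literature.Computability.Complexity.Classes
import Literature.Computability.Complexity.Nondeterministic
import Literature.Computability.Complexity.CNF
import Literature.Computability.Complexity.BoolEncodings
import Literature.Computability.Complexity.CircuitClasses
import HarnessLib

/-!
# Instance compression: OR-compression and `coNP ⊆ NP/poly`

Named facts (statements only, `def … : Prop`) from the theory of instance compression /
kernelization lower bounds, vendored for route `PneNP/ORIncompressibility`
(items `ORIncompressibility.NoORCompression`, `ORIncompressibility.CompressionCollapse`):

* `orSAT_compressible_imp_coNP_subset_polyAdvice_NP` — **Fortnow–Santhanam** (STOC 2008 /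
  JCSS 2011), Thm. 1.2 = Thm. 3.1: if OR-SAT is compressible — a deterministic polynomial-time `f`
  and an ARBITRARY set `A` with `|f(φ₁, …, φ_m, 1ⁿ)| ≤ poly(n)` (bound independent of `m`) and
  `f(φ₁, …, φ_m, 1ⁿ) ∈ A` iff at least one `φᵢ` is satisfiable, for all lists of formulas of
  size at most `n` — then `coNP ⊆ NP/poly` (and `PH` collapses to the third level, Yap).
* `complementaryWitness_mapping` — **Dell–van Melkebeek** (STOC 2010 / J. ACM 2014), Lemma 4
  (Complementary Witness Lemma), in the case of polynomial-time MAPPING compressions (the case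
  the authors attribute to Fortnow–Santhanam, §6.1): for any language `L`, any target set `A`
  and any polynomially bounded `t : ℕ → ℕ ∖ {0}`, a polynomial-time map sending every tuple of
  `t(s)` strings of length at most `s` (with `1ˢ` appended) to a string of length
  `O(t(s) log t(s))` whose membership in `A` decides `∃ i, xᵢ ∈ L`, puts `L` in `coNP/poly`.
  The printed lemma allows oracle communication protocols with a conondeterministic first
  player; a mapping reduction to `A` is the protocol "send `f(x̄)`, the oracle answers `A`", of
  cost `|f(x̄)|`, so this `def` is the many-one special case of the printed statement.

Encodings (tree conventions, `BoolEncodings.lean`): a tuple `(x₁, …, x_t)` is the iterated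
self-delimiting pair `xs.foldr boolPair []` written inline exactly as the route decl does (propositionally
the tree's `encList xs` of `StackLists.lean`, cf. `foldr_boolPair_eq_encList`); the unary length parameter `1ⁿ` is
`List.replicate n true`, glued on with `boolPair`; `NP/poly = polyAdvice NP`,
`coNP/poly = polyAdvice coNP` (`CircuitClasses.polyAdvice`, Arora–Barak Def. 6.16).
"Computable in time `poly(m, n)`" (FS) is `f ∈ FP`: the code of `m` formulas of size `≤ n` plus
`1ⁿ` has length between `2m + n + 2` and `m(2n + 2) + n + 2`.

## References

* [FortnowSanthanam2011] L. Fortnow, R. Santhanam, *Infeasibility of instance compression and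
  succinct PCPs for NP*, J. Comput. System Sci. 77 (2011) 91–106 (STOC 2008), §1 Thm. 1.2, §3
  Thm. 3.1 and its proof ("Theorem 3.1 below is just Theorem 1.2 re-phrased using the terminology
  of compression"; hypothesis as used in the proof: "there is a language A and a function f
  computable in deterministic time poly(m, n) such that |f(φ₁, …, φ_m, 1ⁿ)| ≤ n^c for some
  constant c independent of m, and f(φ₁, …, φ_m, 1ⁿ) ∈ A if and only if at least one of the φᵢ
  are satisfiable"; conclusion "coNP ⊆ NP/poly, and hence the polynomial-time hierarchy collapses
  to the third level") — held, s2orc text key paper:doi-10-1145-1374376-1374398 chunks 2, 3, 7.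
* [DellVanmelkebeek2014] H. Dell, D. van Melkebeek, *Satisfiability allows no nontrivial
  sparsification unless the polynomial-time hierarchy collapses*, J. ACM 61 (2014) Art. 23
  (STOC 2010), Lemma 4 (Complementary Witness Lemma) p. 23:13 and §6.1 (proof; the
  Fortnow–Santhanam mapping case) — held, key paper:doi-10-1145-2629620 chunks 13, 26.
* A. Drucker, *New limits to classical and quantum instance compression*, SIAM J. Comput. 44
  (2015) 1443–1479, Def. 4.16 (compression reductions in the exact-length regime
  `{0,1}^{t₁(n)×n} → {0,1}^{≤ t₂(n)}`) and Thm. 7.1 (probabilistic OR-compression) — context only.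
-/

namespace Literature.Computability.Complexity

open Filter

/-- `IsORCompression L f A c`: the candidate `f` OR-compresses `L` into the (arbitrary) target set
`A` with output bound `c`: for every `s` and EVERY tuple `x̄ = (x₁, …, x_m)` of strings of length at
most `s` (any number `m` of them), `|f ⟨x̄, 1ˢ⟩| ≤ c s` and `f ⟨x̄, 1ˢ⟩ ∈ A ↔ ∃ i, xᵢ ∈ L` —
Fortnow–Santhanam's "OR(L) is compressible within A" with size bound independent of `m`.
[cite: FortnowSanthanam2011, §1 Thm 1.2 and §3 (compressibility of OR-SAT within A)] -/
def IsORCompression (L : Language Bool) (f : List Bool → List Bool) (A : Set (List Bool))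
    (c : ℕ → ℕ) : Prop :=
  ∀ (s : ℕ) (xs : List (List Bool)), (∀ x ∈ xs, x.length ≤ s) →
    (f (boolPair (xs.foldr boolPair []) (List.replicate s true))).length ≤ c s ∧
      (f (boolPair (xs.foldr boolPair []) (List.replicate s true)) ∈ A ↔ ∃ x ∈ xs, x ∈ L)

/-- `IsORCompressionAt L f A c t`: the same, but required only of tuples of exactly `t s` strings
of length at most `s` — the regime of Dell–van Melkebeek's Lemma 4 ("at least one out of `t(s)`
inputs of length at most `s`") and of Drucker's Def. 4.16 (compression reductions that "work only
in narrow input-regimes"). [cite: DellVanmelkebeek2014, Lemma 4] -/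
def IsORCompressionAt (L : Language Bool) (f : List Bool → List Bool) (A : Set (List Bool))
    (c t : ℕ → ℕ) : Prop :=
  ∀ (s : ℕ) (xs : List (List Bool)), xs.length = t s → (∀ x ∈ xs, x.length ≤ s) →
    (f (boolPair (xs.foldr boolPair []) (List.replicate s true))).length ≤ c s ∧
      (f (boolPair (xs.foldr boolPair []) (List.replicate s true)) ∈ A ↔ ∃ x ∈ xs, x ∈ L)

/-- An everywhere OR-compression is one in every regime `t`. [folklore] -/
theorem IsORCompression.at {L : Language Bool} {f : List Bool → List Bool} {A : Set (List Bool)}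
    {c : ℕ → ℕ} (h : IsORCompression L f A c) (t : ℕ → ℕ) : IsORCompressionAt L f A c t :=
  fun s xs _ hxs => h s xs hxs

/-- **Fortnow–Santhanam (2008/2011), Thm. 1.2 (= Thm. 3.1): if OR-SAT is compressible then
`coNP ⊆ NP/poly`.** Printed hypothesis (proof of Thm. 3.1): "there is a language A and a
function f computable in deterministic time poly(m, n) such that |f(φ₁, …, φ_m, 1ⁿ)| ≤ n^c for
some constant c independent of m, and f(φ₁, …, φ_m, 1ⁿ) ∈ A if and only if at least one of the
φᵢ are satisfiable" (φᵢ formulas of size at most n, ANY number m of them; A arbitrary); printed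
conclusion: "coNP ⊆ NP/poly, and hence the polynomial-time hierarchy collapses to the third
level" — the PH collapse (Yap 1983: `coNP ⊆ NP/poly ⇒ PH = Σ₃ᵖ`) is a separate cited corollary
and is deliberately NOT part of this `def` (the tree's Karp–Lipton/Yap plumbing lives in
`KarpLipton.lean` / `PolyAdvicePH.lean`). Here `SAT` is the tree's CNF-satisfiability language, the
bound `n^c` is a polynomial `p`, and "time poly(m, n)" is `f ∈ FP` (see the module docstring). Conditional context for
`Summit.PneNP.PneNP.Theses.ORIncompressibility.NoORCompression`: its NEGATION supplies a
compressor only for `m = n^c` blocks of length EXACTLY `n` at cofinitely many `n` — covered by the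
FS proof (which uses only `m = n^c` and size-`n` unsatisfiable formulas) but NOT an instance of
this printed hypothesis; and for `…ORIncompressibility.CompressionCollapse` (FS's open question:
remove the advice, i.e. conclude `NP = coNP`). [cite: FortnowSanthanam2011, Thm 1.2 (= Thm 3.1)] -/
def orSAT_compressible_imp_coNP_subset_polyAdvice_NP : Prop :=
  (∃ f ∈ FP, ∃ (A : Set (List Bool)) (p : Polynomial ℕ), IsORCompression SAT f A fun n => p.eval n) →
    coNP ⊆ polyAdvice Nondeterministic.NP

/-- **Dell–van Melkebeek (2010/2014), Lemma 4 (Complementary Witness Lemma) — mapping case.**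
Printed: "Let L be a language and t : ℕ → ℕ ∖ {0} be polynomially bounded such that the problem
of deciding whether at least one out of t(s) inputs of length at most s belongs to L has an
oracle communication protocol of cost O(t(s) log t(s)), where the first player can be
conondeterministic. Then L ∈ coNP/poly." This `def` is the special case in which the protocol is
a deterministic polynomial-time mapping `f` into an arbitrary set `A` (cost = `|f(x̄)|`), the case
the authors credit to Fortnow–Santhanam (§6.1: "t-tuples consisting of instances of bitlength s
are mapped to an instance of bitlength bounded by some fixed polynomial in s"); `O(·)` is read as
`∃ C s₀, ∀ s ≥ s₀`. With `L = SAT`, `t s = s^c`, cost `s^a` (`a < c`) this is the shape of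
`¬ Summit.PneNP.PneNP.Theses.ORIncompressibility.NoORCompression`, except that the item fixes the
block length to EXACTLY `s` and asks correctness only for cofinitely many `s` (the printed proof,
§6.1, works length by length with "at most 2ˢ instances of bitlength s", so it covers that case,
but the printed statement does not instantiate to it). [cite: DellVanmelkebeek2014, Lemma 4 (Complementary Witness Lemma) and §6.1] -/
def complementaryWitness_mapping : Prop :=
  ∀ (L : Language Bool) (A : Set (List Bool)) (t c : ℕ → ℕ) (f : List Bool → List Bool),
    (∀ s, 0 < t s) → (∃ p : Polynomial ℕ, ∀ s, t s ≤ p.eval s) → f ∈ FP →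
    IsORCompressionAt L f A c t →
    (∃ (C : ℝ) (s₀ : ℕ), ∀ s ≥ s₀, (c s : ℝ) ≤ C * ((t s : ℝ) * Real.log (t s))) →
      L ∈ polyAdvice coNP

end Literature.Computability.Complexity
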